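import Summits.ABC.IUTFork.Cor312PilotIdelesMReadDeep
import HarnessLib

/-!
# [IUTchIII] Cor. 3.12, M-level pilot ideles: the INTEGER ORDER `m_q` of the datum's q-idele at a member of `V̲`
# (`‖t_{q,v̲}‖ = ‖ϖ_{v̲}‖^{m_q}`), its VALUE `2l·e_v·m_q = −e_{v̲}·ord_v(j_E)`, and `m_q = 0` off the bad members

PROOF-ONLY record file (D-0012; no definitions, no `Prop` facts, no instances) of the abc-iut cell (WAVE-5 prover seat
abc-iut-w5-d166, gen 7; D-0079 R-W lane U, companion of the row «W:M-U2-ORDERS» p466948 / p467742 / p467871 / p468955: those files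
decide the M-setting licence by integer predicates in ONE integer `m_q(u)` per member with `‖t_{q,x₀}‖ = ‖ϖ‖^{m_q}` — this file supplies
that integer and its value from the datum). Sequel of this lineage's gen-5 `Cor312PilotIdelesMReadDeep` (p446060). TAKES NO SIDE on
[IUTchIII] Cor. 3.12 or on any author.

For an initial Θ-datum `D`, idele data `r`, a finite rational place `u ∋ p` and a member `x ∈ V̲_u` with genuine carrier
`K_{v̲} = kOfM D p u _ x` (`e_{v̲} = e(K_{v̲}/ℚ_p)`), a norm uniformiser `ϖ` of `K_{v̲}`, `v = placeModOfM D u x ∈ V(F_mod)` the place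
below, `e_v` its absolute ramification index in `F_mod`:
* `exists_int_norm_tqM_eq_zpow` / `exists_int_norm_tThetaM_eq_zpow` — the orders EXIST (`‖y‖ ∈ ‖ϖ‖^ℤ` for every `y ≠ 0`; the ideles are
  units of the completions): `∃ m, ‖t_{q,x}‖ = ‖ϖ‖^m`, `∃ M, ‖t_{Θ,i,x}‖ = ‖ϖ‖^M`;
* `int_order_tqM_eq_zero_of_not_mem` — off `V^bad_mod` the order is `0` (`‖t_{q,x}‖ = 1`, gen-5 `norm_tqM_eq_one_of_not_mem`);
* **`two_mul_l_mul_ramIdx_mul_order_tqM_eq`** — at a BAD member: `2l·e_v·m_q = −e_{v̲}·ord_v(j_E)` (gen-5 `norm_tqM_eq_rpow_ord_jMod`: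
  `‖t_{q,x}‖ = p^{ord_v(j_E)/(2l·e_v)}`, `‖ϖ‖ = p^{−1/e_{v̲}}`); i.e. `m_q = e(v̲|v)·ord_v(q_v)/(2l)` — POSITIVE;
* **`two_mul_l_mul_order_tqM_eq_of_j_eq`** — RATIONAL `j`-invariant `j_E = j₀ ∈ ℚ`: `2l·m_q = −e_{v̲}·ord_u(j₀)` (gen-5
  `norm_tqM_eq_rpow_ord_rat`: the ramification of the opaque fields cancels) — e.g. `j₀` of a Frey curve at `p ∣ abc`:
  `m_q = e_{v̲}·ord_p(1/j₀)/(2l)`.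
So the R-W WINDOW-TABLE's M column `m_q(u)` is a kernel quantity: with `Cor312LicenceExactOrdersMRational`
(`licence_settingPrVolSharpM_tOfIdeleData_iff_orders_of_j_mem_range`) the verdict of a rational-`j` M row is the list of integer tests
`e·(((i+1)²·m_q − (i+1)·D − (i+2)·R_in)/e) + (i+2)·R_out ≤ m_q` with THIS `m_q`. HONEST SCOPE: identities about OUR typed ideles of a
HYPOTHETICAL initial Θ-datum (existence at a given triple not claimed); nothing about the printed inequality; no side taken.
[cite: Mochizuki2012, IUTchI Def. 3.1 (b)(e) p. 61–62, Ex. 3.2 (iv) p. 67; IUTchIII Cor. 3.12 Step (xi-f) p. 184]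
[cite: DupuyHilado2025, §3.3, §3.4, §3.9] [cite: NeukirchANT1999, Ch. I (8.2), Ch. II (5.5)] [claim: Mochizuki2012, status: disputed]
for every IUT sentence quoted. typed ≠ proved (these: proved); instantiated ≠ endorsed.
-/

noncomputable section

open Set Function NumberField IsDedekindDomain

namespace Summit.ABC.IUTFork.Thm311.Real

open Cor312Vol Cor312Prov Literature.IUT.LogThetaLattice Literature.IUT.LogVolume Literature.IUT.HodgeTheaters
  Literature.NumberTheory.NumberFields Literature.NumberTheory.GaloisRepresentations.Ultrametric

variable {F K Fbar : Type} [Field F] [NumberField F] [Field K] [NumberField K] [Algebra F K]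
  [Field Fbar] [Algebra F Fbar] [Algebra K Fbar] {E : WeierstrassCurve F} [E.IsElliptic] {l : ℕ}
  {Pb : BadPlacePredicates K} (D : InitialThetaData F K Fbar E l Pb)
  (p : ℕ) [hp : Fact p.Prime] (u : FinitePlace ℚ) (hu : ((p : ℕ) : 𝓞 ℚ) ∈ (FinitePlace.maximalIdeal u).asIdeal)
  (r : ThetaData.IdeleData D)

/-! ## §1. The orders exist -/

/-- **The q-idele has an integer order**: `‖t_{q,x}‖ = ‖ϖ‖^{m}` for some `m ∈ ℤ` (`t_{q,x} ≠ 0` and the norm group of `K_{v̲}^×` is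
`‖ϖ‖^ℤ`). [cite: NeukirchANT1999, Ch. II (5.5)] -/
theorem exists_int_norm_tqM_eq_zpow (x : (thetaIndexOfInitial D).Fibre (Val.non u)) {ϖ : (kOfM D p u hu x)ˣ}
    (hϖ : IsUniformizer ϖ) : ∃ m : ℤ, ‖tqM D p u hu r x‖ = ‖(ϖ : kOfM D p u hu x)‖ ^ m :=
  hϖ.2 (Units.mk0 _ (tqM_ne_zero D p u hu r x))

/-- **The Θ-idele has an integer order**: `‖t_{Θ,i,x}‖ = ‖ϖ‖^{M}` for some `M ∈ ℤ`. [cite: NeukirchANT1999, Ch. II (5.5)] -/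
theorem exists_int_norm_tThetaM_eq_zpow (i : Fin (thetaIndexOfInitial D).lstar) (x : (thetaIndexOfInitial D).Fibre (Val.non u))
    {ϖ : (kOfM D p u hu x)ˣ} (hϖ : IsUniformizer ϖ) :
    ∃ M : ℤ, ‖tThetaM D p u hu r i x‖ = ‖(ϖ : kOfM D p u hu x)‖ ^ M :=
  hϖ.2 (Units.mk0 _ (tThetaM_ne_zero D p u hu r i x))

/-- **Off `V^bad_mod` the order of the q-idele is `0`** (`‖t_{q,x}‖ = 1`, gen-5 `norm_tqM_eq_one_of_not_mem`; `‖ϖ‖ < 1`).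
[cite: DupuyHilado2025, §3.3, §3.4] -/
theorem int_order_tqM_eq_zero_of_not_mem (x : (thetaIndexOfInitial D).Fibre (Val.non u))
    (hx : placeModOfM D u x ∉ (ThetaData.pilotData D).S) {ϖ : (kOfM D p u hu x)ˣ} (hϖ : IsUniformizer ϖ) {m : ℤ}
    (hm : ‖tqM D p u hu r x‖ = ‖(ϖ : kOfM D p u hu x)‖ ^ m) : m = 0 := by
  rw [norm_tqM_eq_one_of_not_mem D p u hu r x hx] at hm
  refine zpow_right_injective₀ (norm_pos_iff.2 ϖ.ne_zero) hϖ.1.ne ?_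
  show ‖(ϖ : kOfM D p u hu x)‖ ^ m = ‖(ϖ : kOfM D p u hu x)‖ ^ (0 : ℤ)
  rw [zpow_zero, ← hm]

/-! ## §2. The value of the order at a bad member -/

include hu in
/-- **`2l·e_v·m_q = −e_{v̲}·ord_v(j_E)` at a BAD member** (`v = placeModOfM D u x ∈ V^bad_mod`, `e_v` the absolute ramification index of
`F_mod` at `v`, `e_{v̲} = e(K_{v̲}/ℚ_p)`): compare `‖t_{q,x}‖ = p^{ord_v(j_E)/(2l·e_v)}` (gen-5 `norm_tqM_eq_rpow_ord_jMod`) with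
`‖ϖ‖^{m_q} = p^{−m_q/e_{v̲}}`. Equivalently `m_q = e(v̲|v)·ord_v(q_v)/(2l)` with `ord_v(q_v) = −ord_v(j_E) > 0`. [cite: DupuyHilado2025, §3.3, §3.4]
[cite: NeukirchANT1999, Ch. I (8.2), Ch. II (5.5)] [cite: Mochizuki2012, IUTchI Ex. 3.2 (iv) p. 67] -/
theorem two_mul_l_mul_ramIdx_mul_order_tqM_eq (x : (thetaIndexOfInitial D).Fibre (Val.non u))
    (hx : placeModOfM D u x ∈ (ThetaData.pilotData D).S) {ϖ : (kOfM D p u hu x)ˣ} (hϖ : IsUniformizer ϖ) {m : ℤ}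
    (hm : ‖tqM D p u hu r x‖ = ‖(ϖ : kOfM D p u hu x)‖ ^ m) :
    (2 * l * ramIdx (fieldOfModuli E) (placeModOfM D u x) : ℤ) * m =
      -(absRamificationIdx p (kOfM D p u hu x) : ℤ) * ord (fieldOfModuli E) (placeModOfM D u x) (ThetaData.jMod E) := by
  have hp0 : (0 : ℝ) < (p : ℝ) := by exact_mod_cast hp.out.pos
  have hp1 : (1 : ℝ) < (p : ℝ) := by exact_mod_cast hp.out.one_lt
  have he : (0 : ℝ) < (absRamificationIdx p (kOfM D p u hu x) : ℝ) := by exact_mod_cast absRamificationIdx_pos p _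
  have hev : (0 : ℝ) < (ramIdx (fieldOfModuli E) (placeModOfM D u x) : ℝ) := by
    exact_mod_cast Nat.pos_of_ne_zero (ramIdx_ne_zero _ _)
  have hl : (0 : ℝ) < (l : ℝ) := by exact_mod_cast lt_of_lt_of_le (by norm_num) D.five_le_l
  have h1 := norm_tqM_eq_rpow_ord_jMod D p u hu r x hx
  rw [hm, norm_eq_rpow_of_isUniformizer p _ hϖ, ← Real.rpow_intCast, ← Real.rpow_mul hp0.le] at h1
  -- equal powers of `p > 1` have equal exponents
  have hexp : -(1 / (absRamificationIdx p (kOfM D p u hu x) : ℝ)) * (m : ℝ) =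
      (ord (fieldOfModuli E) (placeModOfM D u x) (ThetaData.jMod E) : ℝ) /
        (2 * l * ramIdx (fieldOfModuli E) (placeModOfM D u x)) :=
    le_antisymm ((Real.rpow_le_rpow_left_iff hp1).mp h1.le) ((Real.rpow_le_rpow_left_iff hp1).mp h1.ge)
  have h2lev : (0 : ℝ) < 2 * l * ramIdx (fieldOfModuli E) (placeModOfM D u x) := by positivity
  rw [eq_div_iff h2lev.ne', neg_mul, one_div, inv_mul_eq_div, neg_mul, div_mul_eq_mul_div, neg_eq_iff_eq_neg,
    div_eq_iff he.ne'] at hexp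
  have h3 : (((2 * l * ramIdx (fieldOfModuli E) (placeModOfM D u x) : ℤ) * m : ℤ) : ℝ) =
      ((-(absRamificationIdx p (kOfM D p u hu x) : ℤ) * ord (fieldOfModuli E) (placeModOfM D u x) (ThetaData.jMod E) : ℤ) : ℝ) := by
    push_cast
    linarith
  exact_mod_cast h3

include hu in
/-- **The order is POSITIVE at a bad member** (`ord_v(j_E) < 0` there). [cite: DupuyHilado2025, §3.3] -/
theorem int_order_tqM_pos_of_mem (x : (thetaIndexOfInitial D).Fibre (Val.non u))
    (hx : placeModOfM D u x ∈ (ThetaData.pilotData D).S) {ϖ : (kOfM D p u hu x)ˣ} (hϖ : IsUniformizer ϖ) {m : ℤ}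
    (hm : ‖tqM D p u hu r x‖ = ‖(ϖ : kOfM D p u hu x)‖ ^ m) : 0 < m := by
  have hlt := norm_tqM_lt_one D p u hu r x hx
  rw [hm] at hlt
  exact (zpow_lt_one_iff_right_of_lt_one₀ (norm_pos_iff.2 ϖ.ne_zero) hϖ.1).mp hlt

/-! ## §3. Rational `j`-invariant: the ramification cancels -/

include hu in
/-- **RATIONAL `j`: `2l·m_q = −e_{v̲}·ord_u(j₀)`** for `j_E = j₀ ∈ ℚ` at a bad member (gen-5 `norm_tqM_eq_rpow_ord_rat`:
`‖t_{q,x}‖ = p^{ord_u(j₀)/(2l)}`, no index of the opaque fields left) — e.g. for a Frey curve at `p ∣ abc`: `m_q = e_{v̲}·ord_p(1/j₀)/(2l)`.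
[cite: DupuyHilado2025, §3.4] [cite: NeukirchANT1999, Ch. I (8.2)] -/
theorem two_mul_l_mul_order_tqM_eq_of_j_eq (x : (thetaIndexOfInitial D).Fibre (Val.non u))
    (hx : placeModOfM D u x ∈ (ThetaData.pilotData D).S) (j₀ : ℚ) (hj : E.j = (j₀ : F)) {ϖ : (kOfM D p u hu x)ˣ}
    (hϖ : IsUniformizer ϖ) {m : ℤ} (hm : ‖tqM D p u hu r x‖ = ‖(ϖ : kOfM D p u hu x)‖ ^ m) :
    (2 * l : ℤ) * m =
      -(absRamificationIdx p (kOfM D p u hu x) : ℤ) *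
        ord ℚ (Literature.IUT.LogVolume.finBelow ℚ (fieldOfModuli E) (placeModOfM D u x)) j₀ := by
  have hp0 : (0 : ℝ) < (p : ℝ) := by exact_mod_cast hp.out.pos
  have hp1 : (1 : ℝ) < (p : ℝ) := by exact_mod_cast hp.out.one_lt
  have he : (0 : ℝ) < (absRamificationIdx p (kOfM D p u hu x) : ℝ) := by exact_mod_cast absRamificationIdx_pos p _
  have hl : (0 : ℝ) < (l : ℝ) := by exact_mod_cast lt_of_lt_of_le (by norm_num) D.five_le_l
  have h1 := norm_tqM_eq_rpow_ord_rat D p u hu r x hx j₀ hj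
  rw [hm, norm_eq_rpow_of_isUniformizer p _ hϖ, ← Real.rpow_intCast, ← Real.rpow_mul hp0.le] at h1
  have hexp : -(1 / (absRamificationIdx p (kOfM D p u hu x) : ℝ)) * (m : ℝ) =
      (ord ℚ (Literature.IUT.LogVolume.finBelow ℚ (fieldOfModuli E) (placeModOfM D u x)) j₀ : ℝ) / (2 * l) :=
    le_antisymm ((Real.rpow_le_rpow_left_iff hp1).mp h1.le) ((Real.rpow_le_rpow_left_iff hp1).mp h1.ge)
  have h2l : (0 : ℝ) < 2 * l := by positivity
  rw [eq_div_iff h2l.ne', neg_mul, one_div, inv_mul_eq_div, neg_mul, div_mul_eq_mul_div, neg_eq_iff_eq_neg,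
    div_eq_iff he.ne'] at hexp
  have h3 : (((2 * l : ℤ) * m : ℤ) : ℝ) =
      ((-(absRamificationIdx p (kOfM D p u hu x) : ℤ) *
        ord ℚ (Literature.IUT.LogVolume.finBelow ℚ (fieldOfModuli E) (placeModOfM D u x)) j₀ : ℤ) : ℝ) := by
    push_cast
    linarith
  exact_mod_cast h3

end Summit.ABC.IUTFork.Thm311.Real

end
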